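import Literature.Computability.AlgebraicComplexity.BorderRankMatMulThreeTransport
import Literature.Computability.AlgebraicComplexity.BorderRankMatMulThreeEnum
import Literature.Computability.AlgebraicComplexity.BorderRankMatMulThreeVerdictRun
import Literature.Computability.AlgebraicComplexity.BorderRankMatMulThreeTripleSound
import Literature.Computability.AlgebraicComplexity.BorderRankMatMulThreeTripleRun
import Literature.Computability.AlgebraicComplexity.BorderRankMatMulSmall
import Literature.Computability.AlgebraicComplexity.StrassenMinimalBorderRank
import Literature.Computability.AlgebraicComplexity.SchoenhageTauBini
import HarnessLib

/-!
# `R̲(M⟨3⟩) ≥ 17` (Conner–Harper–Landsberg 2023, Theorem 1.1) — the discharge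

Topic `Literature/Computability/AlgebraicComplexity`. The named fact
`ConnerHarperLandsberg2023_thm_1_1 : 17 ≤ algBorderRank (matMulTensor ℂ 3 3 3)`
(`BorderRankMatMulSmall.lean`) DISCHARGED, over every field of characteristic `0`, by CHL's
Borel-fixed border apolarity:

* if `bR(⟨3,3,3⟩) ≤ 16` then some order-`h` approximate decomposition has `16` triads
  (`exists_algBorderRank_eq_approxRank`, `exists_isApproxDecomposition_of_approxRank_le`);
* it yields a candidate triple `(E₁, E₂, E₃)` whose three members, in `(110)` coordinates
  (`σ₂`, `σ₃`), are admissible and pass the `(210)`/`(120)` tests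
  (`MatMul3.exists_admissible_triple`, `BorderRankMatMulThreeTransport.lean`);
* by the kernel verdicts on the `272` killed profiles (`MatMul3.killedProfs_verdict`) each member's
  profile is one of the eight survivors (`MatMul3.IsAdmissible.mem_survivors8`);
* the members lie in the dual models of their profiles (`MatMul3.IsAdmissible.le_dualModel`), so the
  `(111)`-test dimension is `≤ Ker.bound111 ≤ 15` (`MatMul3.finrank_tripleInter_le_bound111`,
  `MatMul3.bound111_le_of_mem_survivors8`) — contradicting `16 ≤ dim` of the candidate triple.

* `seventeen_le_algBorderRank_matMulTensor_three` — **`17 ≤ bR(⟨3,3,3⟩)` in characteristic `0`;**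
* `ConnerHarperLandsberg2023_thm_1_1_holds` — the named fact over `ℂ`.

## References

* A. Conner, A. Harper, J. M. Landsberg, *New lower bounds for matrix multiplication and `det₃`*,
  Forum Math. Pi 11 (2023) e17, arXiv:1911.07981 — Thm. 1.1, §6. [ConnerHarperLandsberg2023]
-/

noncomputable section

open Polynomial
open scoped Polynomial BigOperators

namespace Literature.Computability.AlgebraicComplexity

open BorderApolarity BorderApolarity.MatMul3 TensorApolarity

universe u

/-- **Conner–Harper–Landsberg 2023, Theorem 1.1, over any field of characteristic `0`:
`17 ≤ R̲(⟨3,3,3⟩)`** (algebraic border rank over `K[ε]`), by Borel-fixed border apolarity with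
the `(210)`, `(120)`, `(111)` tests evaluated by the kernel. [cite: ConnerHarperLandsberg2023, Thm. 1.1] -/
theorem seventeen_le_algBorderRank_matMulTensor_three (K : Type) [Field K] [CharZero K] :
    17 ≤ algBorderRank (matMulTensor K 3 3 3) := by
  by_contra hlt
  -- an order-`h` approximate decomposition with `16` triads
  obtain ⟨h, hh⟩ := exists_algBorderRank_eq_approxRank (matMulTensor K 3 3 3)
  have hr : approxRank h (matMulTensor K 3 3 3) ≤ 16 := by rw [← hh]; omega
  obtain ⟨u, v, w, hd⟩ := exists_isApproxDecomposition_of_approxRank_le hr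
  -- the admissible candidate triple
  obtain ⟨E₁, E₂, E₃, hc, hA₁, hA₂, hA₃, hI₂, hK₂, hI₃, hK₃⟩ := exists_admissible_triple K hd
  -- all three profiles survive `(210)`/`(120)` …
  have hs₁ := hA₁.mem_survivors8 killedProfs_verdict hc.testI₁ hc.testK₁
  have hs₂ := hA₂.mem_survivors8 killedProfs_verdict hI₂ hK₂
  have hs₃ := hA₃.mem_survivors8 killedProfs_verdict hI₃ hK₃
  -- … so the `(111)` test fails
  have hb := finrank_tripleInter_le_bound111 hA₁.le_dualModel hA₂.le_dualModel hA₃.le_dualModel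
  have h15 : Module.finrank K (tripleInter E₁ E₂ E₃) ≤ 15 :=
    hb.trans (bound111_le_of_mem_survivors8 hs₁ hs₂ hs₃)
  have h16' : 16 ≤ 15 := hc.triple.trans h15
  omega

/-- **Conner–Harper–Landsberg 2023, Theorem 1.1: `R̲(M⟨3⟩) ≥ 17`** — the named fact
`ConnerHarperLandsberg2023_thm_1_1` of `BorderRankMatMulSmall.lean` discharged.
[cite: ConnerHarperLandsberg2023, Thm. 1.1] -/
theorem ConnerHarperLandsberg2023_thm_1_1_holds : ConnerHarperLandsberg2023_thm_1_1 :=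
  seventeen_le_algBorderRank_matMulTensor_three ℂ

end Literature.Computability.AlgebraicComplexity

end
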